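import Literature.MathematicalPhysics.QuantumChemistry.SlaterCondonRulesTransitions
import Literature.MathematicalPhysics.QuantumChemistry.SlaterCondonRulesDouble
import HarnessLib

/-!
# The Slater–Condon rules, IV: the spin-free molecular Hamiltonian in the orbital basis

Part IV: Helgaker–Jørgensen–Olsen (2000) §2.2.1 writes a spin-free one- or two-electron operator in
the spin-orbital basis with the integrals `f_{pσ,qτ} = f_pq δ_στ` (2.2.3) and
`g_{pσ,qτ,rμ,sν} = g_pqrs δ_στ δ_μν` (2.2.10) (`spinFreeOne`, `spinFreeTwo` below), whence
`Σ_{PQ} f_PQ a†_P a_Q = Σ_pq f_pq E_pq` (2.2.6) and `½ Σ g_PQRS a†_P a†_R a_S a_Q = ½ Σ g_pqrs e_pqrs`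
(2.2.15): the tree's orbital-basis Hamiltonian `molecularHamiltonian h g h_nuc` (HJO (2.2.18),
`SecondQuantizedHamiltonian.lean`) is the spin-orbital Hamiltonian (1.4.39)
`dGamma (spinFreeOne h) + twoElectronOp (spinFreeTwo g) + h_nuc`
(`molecularHamiltonian_eq_dGamma_add_twoElectronOp`). The Slater–Condon rules of parts I–III then
give the matrix elements of `molecularHamiltonian h g h_nuc` between ON vectors (determinants):
`molecularHamiltonian_apply_self` (diagonal, (1.4.3)+(1.4.18)), `_apply_single` (one replacement,
(1.4.6)+(1.4.21)), `_apply_double` (two replacements, (1.4.24)), `_apply_eq_zero_of` (more,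
(1.4.7)+(1.4.25)); the symmetry `g_pqrs = g_rspq` (2.2.12) supplies (1.4.17). Everything is PROVED
(0 sorry); the two definitions are the printed integral tables.

## References

* T. Helgaker, P. Jørgensen, J. Olsen, *Molecular Electronic-Structure Theory*, Wiley (2000), §1.4.3
  eq. (1.4.39), §2.2.1 eqs. (2.2.2)–(2.2.18); held copy
  `book:helgakernd-molecular-electronic-structure-theory` (chunks p0049, p0072–p0073 read
  2026-08-21). [cite: HelgakerJorgensenOlsen2000, §2.2.1]
-/

noncomputable section

namespace Literature.MathematicalPhysics.QuantumChemistry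

open Matrix Finset
open Literature.MathematicalPhysics.QuantumLattice

section Molecular

variable {Λ : Type*} [LinearOrder Λ] [Fintype Λ]

/-- The **spin-orbital one-electron integrals of a spin-free operator**: `f_{pσ,qτ} = f_pq δ_{στ}`.
Helgaker–Jørgensen–Olsen (2000) eq. (2.2.3). [cite: HelgakerJorgensenOlsen2000, eq. (2.2.3)] -/
def spinFreeOne (h : Λ → Λ → ℂ) : Matrix (Orb Λ) (Orb Λ) ℂ :=
  fun P Q => if (ofLex P).2 = (ofLex Q).2 then h (ofLex P).1 (ofLex Q).1 else 0

/-- The **spin-orbital two-electron integrals of a spin-free operator**: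
`g_{pσ,qτ,rμ,sν} = g_pqrs δ_{στ} δ_{μν}`. Helgaker–Jørgensen–Olsen (2000) eq. (2.2.10).
[cite: HelgakerJorgensenOlsen2000, eq. (2.2.10)] -/
def spinFreeTwo (g : Λ → Λ → Λ → Λ → ℂ) : Orb Λ → Orb Λ → Orb Λ → Orb Λ → ℂ :=
  fun P Q R S => if (ofLex P).2 = (ofLex Q).2 ∧ (ofLex R).2 = (ofLex S).2 then
    g (ofLex P).1 (ofLex Q).1 (ofLex R).1 (ofLex S).1 else 0

omit [LinearOrder Λ] [Fintype Λ] in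
/-- `f_{pσ,qτ} = δ_{στ} f_pq`. [cite: HelgakerJorgensenOlsen2000, eq. (2.2.3)] -/
@[simp] theorem spinFreeOne_orb (h : Λ → Λ → ℂ) (p q : Λ) (σ τ : Fin 2) :
    spinFreeOne h (orb p σ) (orb q τ) = if σ = τ then h p q else 0 := rfl

omit [LinearOrder Λ] [Fintype Λ] in
/-- `g_{pσ,qτ,rμ,sν} = δ_{στ} δ_{μν} g_pqrs`. [cite: HelgakerJorgensenOlsen2000, eq. (2.2.10)] -/
@[simp] theorem spinFreeTwo_orb (g : Λ → Λ → Λ → Λ → ℂ) (p q r s : Λ) (σ τ μ ν : Fin 2) :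
    spinFreeTwo g (orb p σ) (orb q τ) (orb r μ) (orb s ν) =
      if σ = τ ∧ μ = ν then g p q r s else 0 := rfl

omit [LinearOrder Λ] [Fintype Λ] in
/-- The particle-interchange symmetry `g_{PQRS} = g_{RSPQ}` (1.4.17) of the spin-orbital integrals
follows from `g_pqrs = g_rspq` (2.2.12). [cite: HelgakerJorgensenOlsen2000, eq. (2.2.12)] -/
theorem spinFreeTwo_swap {g : Λ → Λ → Λ → Λ → ℂ} (hg : ∀ p q r s, g p q r s = g r s p q)
    (P Q R S : Orb Λ) : spinFreeTwo g P Q R S = spinFreeTwo g R S P Q := by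
  simp only [spinFreeTwo, and_comm, hg (ofLex P).1]

omit [LinearOrder Λ] in
/-- A sum over the spin orbitals `Orb Λ = Λ ×ₗ Fin 2` is a sum over orbitals, then spins (the
`Σ_{pσ}` of Helgaker–Jørgensen–Olsen (2000) eq. (2.2.2); helper — cf. `SpinGauged.sum_orb` in
`QuantumLattice/SpinGaugeTransformations.lean`, not imported here). [folklore] -/
private theorem sum_orb_eq_sum_sum (F : Orb Λ → Matrix (Finset (Orb Λ)) (Finset (Orb Λ)) ℂ) :
    ∑ P, F P = ∑ p, ∑ σ : Fin 2, F (orb p σ) := by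
  rw [← Fintype.sum_prod_type' (fun p (σ : Fin 2) => F (orb p σ))]
  exact Fintype.sum_equiv ofLex _ _ fun _ => rfl

/-- **(1.4.2) with the integrals (2.2.3) is (2.2.6)**: `Σ_{PQ} f_{PQ} a†_P a_Q = Σ_{pq} f_pq E_pq`.
[cite: HelgakerJorgensenOlsen2000, eq. (2.2.6)] -/
theorem dGamma_spinFreeOne (h : Λ → Λ → ℂ) :
    dGamma (spinFreeOne h) = ∑ p, ∑ q, h p q • singletExcitation p q := by
  rw [dGamma_eq, sum_orb_eq_sum_sum]
  refine Finset.sum_congr rfl fun p _ => ?_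
  simp only [sum_orb_eq_sum_sum, spinFreeOne_orb, ite_smul, zero_smul, Finset.sum_ite_eq, Finset.mem_univ,
    if_true, singletExcitation, Finset.smul_sum]
  rw [Finset.sum_comm]

/-- **(1.4.15) with the integrals (2.2.10) is (2.2.15)**:
`½ Σ_{PQRS} g_{PQRS} a†_P a†_R a_S a_Q = ½ Σ_{pqrs} g_pqrs e_pqrs`.
[cite: HelgakerJorgensenOlsen2000, eq. (2.2.15)] -/
theorem twoElectronOp_spinFreeTwo (g : Λ → Λ → Λ → Λ → ℂ) :
    twoElectronOp (spinFreeTwo g) =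
      (1 / 2 : ℂ) • ∑ p, ∑ q, ∑ r, ∑ s, g p q r s • twoElectronExcitation p q r s := by
  rw [twoElectronOp, sum_orb_eq_sum_sum]
  congr 1
  refine Finset.sum_congr rfl fun p _ => ?_
  simp only [sum_orb_eq_sum_sum, spinFreeTwo_orb, ite_smul, zero_smul, ite_and, Finset.sum_ite_irrel,
    Finset.sum_const_zero, Finset.sum_ite_eq, Finset.mem_univ, if_true, twoElectronExcitation,
    Finset.smul_sum]
  -- LHS `Σ_σ Σ_q Σ_r Σ_μ Σ_s`, RHS `Σ_q Σ_r Σ_s Σ_σ Σ_μ`: move `σ` inwards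
  rw [Finset.sum_comm]
  refine Finset.sum_congr rfl fun q _ => ?_
  rw [Finset.sum_comm]
  refine Finset.sum_congr rfl fun r _ => ?_
  conv_rhs => rw [Finset.sum_comm]
  refine Finset.sum_congr rfl fun σ _ => ?_
  rw [Finset.sum_comm]

/-- **The spin-orbital form (1.4.39) of the orbital-basis Hamiltonian (2.2.18)**:
`Ĥ = Σ_{PQ} h_{PQ} a†_P a_Q + ½ Σ_{PQRS} g_{PQRS} a†_P a†_R a_S a_Q + h_nuc` with the spin-orbital
integrals (2.2.3), (2.2.10) of the spatial ones. [cite: HelgakerJorgensenOlsen2000, eq. (1.4.39)] -/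
theorem molecularHamiltonian_eq_dGamma_add_twoElectronOp (h : Λ → Λ → ℂ) (g : Λ → Λ → Λ → Λ → ℂ)
    (hnuc : ℂ) :
    molecularHamiltonian h g hnuc =
      dGamma (spinFreeOne h) + twoElectronOp (spinFreeTwo g) +
        hnuc • (1 : Matrix (Finset (Orb Λ)) (Finset (Orb Λ)) ℂ) := by
  rw [dGamma_spinFreeOne, twoElectronOp_spinFreeTwo]
  rfl

/-! ### The Slater–Condon rules for `molecularHamiltonian h g h_nuc` -/

/-- An off-diagonal element of `Ĥ` is the sum of its one- and two-electron parts (the constant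
`h_nuc` is diagonal; helper). [folklore] -/
private theorem molecularHamiltonian_apply_of_ne (h : Λ → Λ → ℂ) (g : Λ → Λ → Λ → Λ → ℂ) (hnuc : ℂ)
    {I J : Finset (Orb Λ)} (hIJ : I ≠ J) :
    molecularHamiltonian h g hnuc I J =
      dGamma (spinFreeOne h) I J + twoElectronOp (spinFreeTwo g) I J := by
  rw [molecularHamiltonian_eq_dGamma_add_twoElectronOp, Matrix.add_apply, Matrix.add_apply,
    Matrix.smul_apply, Matrix.one_apply_ne hIJ, smul_zero, add_zero]

/-- **Slater–Condon, identical determinants, for `Ĥ`** ((1.4.3) + (1.4.18) + `h_nuc`):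
`⟨D|Ĥ|D⟩ = Σ_{P∈D} h_{PP} + ½ Σ_{P,R∈D} (g_{PPRR} − g_{PRRP}) + h_nuc` in spin-orbital integrals.
[cite: HelgakerJorgensenOlsen2000, eq. (1.4.18)] -/
theorem molecularHamiltonian_apply_self (h : Λ → Λ → ℂ) (g : Λ → Λ → Λ → Λ → ℂ) (hnuc : ℂ)
    (D : Finset (Orb Λ)) :
    molecularHamiltonian h g hnuc D D =
      ∑ P ∈ D, spinFreeOne h P P +
        (1 / 2 : ℂ) * ∑ P ∈ D, ∑ R ∈ D, (spinFreeTwo g P P R R - spinFreeTwo g P R R P) + hnuc := by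
  rw [molecularHamiltonian_eq_dGamma_add_twoElectronOp, Matrix.add_apply, Matrix.add_apply,
    Matrix.smul_apply, Matrix.one_apply_eq, smul_eq_mul, mul_one, dGamma_apply_self,
    twoElectronOp_apply_self]

/-- **Slater–Condon, one substitution, for `Ĥ`, arbitrary integral tables** (no permutational
symmetry assumed; (1.4.6) + the four sums of (1.4.35)):
`⟨J∖b∪a| Ĥ |J⟩ = Γ_b^{J} Γ_a^{J∖b} (h_{ab} + ½ Σ_{R∈J} ((g_{abRR} + g_{RRab}) − (g_{aRRb} + g_{RbaR})))` in
spin-orbital integrals. [cite: HelgakerJorgensenOlsen2000, eq. (1.4.35)] -/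
theorem molecularHamiltonian_apply_single_general (h : Λ → Λ → ℂ) (g : Λ → Λ → Λ → Λ → ℂ)
    (hnuc : ℂ) {a b : Orb Λ} {J : Finset (Orb Λ)} (hb : b ∈ J) (ha : a ∉ J) :
    molecularHamiltonian h g hnuc (insert a (J.erase b)) J =
      jwSign b J * jwSign a (J.erase b) *
        (spinFreeOne h a b + (1 / 2 : ℂ) * ∑ R ∈ J,
          ((spinFreeTwo g a b R R + spinFreeTwo g R R a b) -
            (spinFreeTwo g a R R b + spinFreeTwo g R b a R))) := by
  have hne : insert a (J.erase b) ≠ J := fun hI => ha (hI ▸ mem_insert_self a _)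
  rw [molecularHamiltonian_apply_of_ne h g hnuc hne, dGamma_apply_single _ hb ha,
    twoElectronOp_apply_single_general _ hb ha, mul_add]

/-- **Slater–Condon, one substitution, for `Ĥ`** ((1.4.6) + (1.4.21)): for `b` occupied and `a`
empty in `|J⟩` and integrals with `g_pqrs = g_rspq`,
`⟨J∖b∪a| Ĥ |J⟩ = Γ_b^{J} Γ_a^{J∖b} (h_{ab} + Σ_{R∈J} (g_{abRR} − g_{aRRb}))` in spin-orbital integrals.
[cite: HelgakerJorgensenOlsen2000, eq. (1.4.21)] -/
theorem molecularHamiltonian_apply_single (h : Λ → Λ → ℂ) {g : Λ → Λ → Λ → Λ → ℂ}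
    (hg : ∀ p q r s, g p q r s = g r s p q) (hnuc : ℂ) {a b : Orb Λ} {J : Finset (Orb Λ)}
    (hb : b ∈ J) (ha : a ∉ J) :
    molecularHamiltonian h g hnuc (insert a (J.erase b)) J =
      jwSign b J * jwSign a (J.erase b) *
        (spinFreeOne h a b + ∑ R ∈ J, (spinFreeTwo g a b R R - spinFreeTwo g a R R b)) := by
  have hne : insert a (J.erase b) ≠ J := fun hI => ha (hI ▸ mem_insert_self a _)
  rw [molecularHamiltonian_apply_of_ne h g hnuc hne, dGamma_apply_single _ hb ha,
    twoElectronOp_apply_single _ (spinFreeTwo_swap hg) hb ha, mul_add]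

/-- **Slater–Condon, two substitutions, for `Ĥ`, arbitrary integral tables** (no permutational
symmetry assumed): `⟨D∖{K,L}∪{I,J}| Ĥ |D⟩ = ± ½ ((g_{IKJL} − g_{ILJK}) − (g_{JKIL} − g_{JLIK}))` in
spin-orbital integrals, with the phase of `a†_I a†_J a_L a_K |D⟩`.
[cite: HelgakerJorgensenOlsen2000, eq. (1.4.24)] -/
theorem molecularHamiltonian_apply_double_general (h : Λ → Λ → ℂ) (g : Λ → Λ → Λ → Λ → ℂ)
    (hnuc : ℂ) {I J K L : Orb Λ} {D : Finset (Orb Λ)} (hK : K ∈ D) (hL : L ∈ D) (hKL : K ≠ L)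
    (hI : I ∉ D) (hJ : J ∉ D) (hIJ : I ≠ J) :
    molecularHamiltonian h g hnuc (insert I (insert J ((D.erase K).erase L))) D =
      jwSign K D * jwSign L (D.erase K) * jwSign J ((D.erase K).erase L) *
          jwSign I (insert J ((D.erase K).erase L)) *
        ((1 / 2 : ℂ) * ((spinFreeTwo g I K J L - spinFreeTwo g I L J K) -
          (spinFreeTwo g J K I L - spinFreeTwo g J L I K))) := by
  have hne : insert I (insert J ((D.erase K).erase L)) ≠ D := fun h' => hI (h' ▸ mem_insert_self I _)
  rw [molecularHamiltonian_apply_of_ne h g hnuc hne, dGamma_apply_double _ hK hL hKL hI hJ hIJ,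
    twoElectronOp_apply_double_general _ hK hL hKL hI hJ hIJ, zero_add]

/-- **Slater–Condon, two substitutions, for `Ĥ`** ((1.4.7) + (1.4.24)): for `K ≠ L` occupied and
`I ≠ J` empty in `|D⟩` and `g_pqrs = g_rspq`, `⟨D∖{K,L}∪{I,J}| Ĥ |D⟩ = ± (g_{IKJL} − g_{ILJK})` in
spin-orbital integrals, with the phase of `a†_I a†_J a_L a_K |D⟩`.
[cite: HelgakerJorgensenOlsen2000, eq. (1.4.24)] -/
theorem molecularHamiltonian_apply_double (h : Λ → Λ → ℂ) {g : Λ → Λ → Λ → Λ → ℂ}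
    (hg : ∀ p q r s, g p q r s = g r s p q) (hnuc : ℂ) {I J K L : Orb Λ} {D : Finset (Orb Λ)}
    (hK : K ∈ D) (hL : L ∈ D) (hKL : K ≠ L) (hI : I ∉ D) (hJ : J ∉ D) (hIJ : I ≠ J) :
    molecularHamiltonian h g hnuc (insert I (insert J ((D.erase K).erase L))) D =
      jwSign K D * jwSign L (D.erase K) * jwSign J ((D.erase K).erase L) *
          jwSign I (insert J ((D.erase K).erase L)) *
        (spinFreeTwo g I K J L - spinFreeTwo g I L J K) := by
  have hne : insert I (insert J ((D.erase K).erase L)) ≠ D := fun h' => hI (h' ▸ mem_insert_self I _)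
  rw [molecularHamiltonian_apply_of_ne h g hnuc hne, dGamma_apply_double _ hK hL hKL hI hJ hIJ,
    twoElectronOp_apply_double _ (spinFreeTwo_swap hg) hK hL hKL hI hJ hIJ, zero_add]

/-- **Slater–Condon, more than two substitutions, for `Ĥ`** ((1.4.7) + (1.4.25)): `⟨I|Ĥ|J⟩ = 0`
unless `|I⟩`, `|J⟩` have the same electron number and differ in at most two pairs of occupation
numbers. [cite: HelgakerJorgensenOlsen2000, eq. (1.4.25)] -/
theorem molecularHamiltonian_apply_eq_zero_of (h : Λ → Λ → ℂ) (g : Λ → Λ → Λ → Λ → ℂ) (hnuc : ℂ)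
    {I J : Finset (Orb Λ)} (hIJ : ¬(I.card = J.card ∧ (J \ I).card ≤ 2)) :
    molecularHamiltonian h g hnuc I J = 0 := by
  have hne : I ≠ J := by
    rintro rfl
    exact hIJ ⟨rfl, by rw [Finset.sdiff_self, card_empty]; exact Nat.zero_le 2⟩
  have h1 : ¬(I.card = J.card ∧ (J \ I).card ≤ 1) := fun h' => hIJ ⟨h'.1, h'.2.trans one_le_two⟩
  rw [molecularHamiltonian_apply_of_ne h g hnuc hne, dGamma_apply_eq_zero_of _ h1,
    twoElectronOp_apply_eq_zero_of _ hIJ, add_zero]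

end Molecular

end Literature.MathematicalPhysics.QuantumChemistry
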